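import Summits.NavierStokesRegularity.FluidComputer.GateBudgetCarrierPhase
import HarnessLib

/-!
# What no tuning can beat, part 70: THE LEAK FLOOR (i) — the output of a pulse, read in part 14's
# co-rotating frame: `ã(T') - ã(r) ≥ (Kρ²/c_M)·(G(Φ(T')) - G(0)) - 6KL(T' - r)²` whenever the
# trigger obeys `c ≤ c_M` on `[r, T']`, with `G` the phase antiderivative of the squared turned
# carrier and `Φ` the dose phase; at a misfire pin `Φ = kπ ± δ` the oscillatory part of `G` dies
# (SPEC-INPUT-bp1 §BE(4)(i): the output law must be PHASE-RESOLVED — its lower side, the engine)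

Cell `pub-fluidc`, blueprint seat bp1 (gen 36, first item, file 1 of 3); same namespace and
conventions as parts 1–69 (`GateBudget*.lean`); imports part 14 (`GateBudgetCarrierPhase`: §43
`knob_phase_tracking_d`; through it part 1 `RotorKnob`: the mode equations (5.6), the energy
identity, `ã` non-decreasing). Independent of parts 15–69. Two-scale knob family
`rotorCircuit K M ε ρ` from (5.6) (`σ = ρ²e^{-M}`, `μ = ε⁻¹M`; modes `0 = a` carrier, `1 = b`
clock, `2 = c` trigger, `3 = d` transfer, `4 = ã` output); parts 71/72 specialise to the headline
member `M = K¹⁰` on the lattice `ε = kK¹⁰ρ²`. HONEST FRAMING (verbatim): low prior, high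
value-of-information experiment on Tao's machine paradigm; NOT a claim that NS blows up. Nothing
is proved about the Navier–Stokes equations.

## Why (SPEC-INPUT-bp1 §BD(4), §BE(4)(i))

Parts 52–69 bound the misfire ladder's output from ABOVE through the pair `P = d² + ã²`
(`∂ₜP = 2ρ⁻²cad`), which lumps the transfer mode `d` — turned through `≈ kπ` by every pulse and
random-walking by the pin slip — with the monotone output `ã` (`∂ₜã = Kd²`); the rung laws
obtained that way (`Δ√P ≤ δ₀ + 1210/K⁸`, `Δã ≤ 242/K⁸`) say nothing from BELOW, and the crude
relative law `Δã ≤ Kd(r)²(T' - r)` is false in kind (mid-pulse `d ≈ ±a(r)`, not `d(r)`). The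
right object is part 14's co-rotating frame: along the pulse `d(t) = sin Φ(t)·a(r) +
cos Φ(t)·d(r) ± 2L(t - r)` (§43; `Φ(t) = (C(t) - C(r))/ρ²` the dose phase, `L = ε + σ + Kã`),
so `∂ₜã = K·S(t)² + O(KL(t - r))` with `S = sin Φ·a(r) + cos Φ·d(r)` an EXPLICIT sinusoid of
the phase. Since `Φ' = c/ρ²` and the trigger is capped on a pulse (`c ≤ c_M`), the comparison
function `W = ã - (Kρ²/c_M)·G(Φ)`, `G' = S²`, is non-decreasing up to the drift error:
`W' = Kd² - (Kc/c_M)S² ≥ K(d² - S²) ≥ -6KL(T')(t - r)` (`|d|, |S| ≤ 1 + small`) — an FTC-free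
monotonicity argument in the style of parts 14/57 (`Convex.mul_sub_le_image_sub_of_le_deriv`).
This gives §216. The primitive is `G(φ) = (a₀² + d₀²)φ/2 - ((a₀² - d₀²)/4) sin 2φ -
(a₀d₀/2) cos 2φ`; at a misfire the pin `|Φ(T') - kπ| ≤ δ` (part 52 §154) makes `|sin 2Φ| ≤ 2δ`
and `1 - cos 2Φ = 2sin²Φ ≤ 2δ²`, so `G(Φ) - G(0) ≥ (a₀² + d₀²)Φ/2 - δ/2 - δ²` (§215): the
secular term survives whole, whatever the entry direction `(a₀, d₀)` of the carrier — which is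
why the floor does not care how far `d` has random-walked. Parts 71 (the leak law of one pulse:
on the lattice `Kρ²/c_M = 1/((θ + 1/500)kK⁹)` and `k` cancels against `Φ ≈ kπ`) and 72 (every
clean rung leaks `≥ 1/K⁹`; the clean ladder has `≤ K⁹/7 + 1` rungs — against `≍ K⁹/log K` rungs
certified from below by the fine ladder of parts 67/69, so the clean dud horizon is two-sided,
`Θ(K⁹)` up to a logarithm) consume this file.

## What is proved

* §215 `leakPrim` (the definition of `G`), `hasDerivAt_leakPrim` (`G'(φ) = (sin φ·a₀ +
  cos φ·d₀)²`), `leakPrim_pin` (`a₀², d₀² ≤ 1`, `0 ≤ δ`, `|φ - kπ| ≤ δ`, `k : ℕ` ⇒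
  `(a₀² + d₀²)φ/2 - δ/2 - δ² ≤ G(φ) - G(0)`).
* §216 `leak_floor` (THE LEAK COMPARISON; any member `rotorCircuit K M ε ρ` from `delayInit`,
  `0 ≤ ε`, `0 ≤ K`, `0 < ρ`, any `C` with `C' = c`): `0 ≤ r ≤ T'`, `0 < c_M`, `c ≤ c_M` on
  `[r, T']` ⇒ `(Kρ²/c_M)·(G(Φ(T')) - G(0)) - 6K(ε + ρ²e^{-M} + Kã(T'))(T' - r)² ≤ ã(T') - ã(r)`
  with `Φ(T') = (C(T') - C(r))/ρ²` and `(a₀, d₀) = (a(r), d(r))`.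

HONEST LIMITS. (i) §216 is an inequality of the toy circuit valid for every member and every
stretch with a trigger cap; it becomes a FLOOR `≍ 1/K⁹` only where the phase advances by `≍ kπ`
against a cap `c_M ≍ kK¹⁰ρ²`, i.e. on the pulses of the lattice family (parts 71/72); (ii) the
drift error `6KL(T' - r)²` is affordable only on stretches of length `O(K⁻⁹)`; (iii) no upper
(ceiling) counterpart is proved here — the phase-resolved ceiling needs the trigger from below,
which a pulse does not supply uniformly; (iv) nothing about Navier–Stokes.
[cite: Tao2016AveragedNS, §5.5 Theorem 5.3, (5.5), (5.6), (b-eq), (c-eq), (ta-eq), (energy-con)]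
-/

noncomputable section

namespace Summit.NavierStokesRegularity.FluidComputer.GateBudget

open Real Set
open Literature.Analysis.FluidPDE.Tao2016AveragedNS

variable {K ε ρ : ℝ} {X : ℝ → Fin 5 → ℝ} {C : ℝ → ℝ}

/-! ## §215 The leak primitive and its value at a misfire pin -/

/-- §215 THE LEAK PRIMITIVE `G(φ) = (a₀² + d₀²)φ/2 - ((a₀² - d₀²)/4)·sin 2φ - (a₀d₀/2)·cos 2φ`:
an antiderivative in the dose phase `φ` of the squared turned carrier `(sin φ·a₀ + cos φ·d₀)²`
(part 14 §43's phase-tracking picture of the transfer mode `d`).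
[cite: Tao2016AveragedNS, §5.5 Theorem 5.3, (5.5)] -/
def leakPrim (a₀ d₀ φ : ℝ) : ℝ :=
  (a₀ ^ 2 + d₀ ^ 2) * φ / 2 - (a₀ ^ 2 - d₀ ^ 2) / 4 * sin (2 * φ) - a₀ * d₀ / 2 * cos (2 * φ)

/-- §215 `G' = (sin φ·a₀ + cos φ·d₀)²`. [derived: this file §215] -/
theorem hasDerivAt_leakPrim (a₀ d₀ φ : ℝ) :
    HasDerivAt (leakPrim a₀ d₀) ((sin φ * a₀ + cos φ * d₀) ^ 2) φ := by
  have h1 : HasDerivAt (fun ψ : ℝ => (a₀ ^ 2 + d₀ ^ 2) * ψ / 2) ((a₀ ^ 2 + d₀ ^ 2) * 1 / 2) φ :=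
    ((hasDerivAt_id φ).const_mul _).div_const 2
  have h2 : HasDerivAt (fun ψ : ℝ => sin (2 * ψ)) (cos (2 * φ) * (2 * 1)) φ :=
    ((hasDerivAt_id φ).const_mul 2).sin
  have h3 : HasDerivAt (fun ψ : ℝ => cos (2 * ψ)) (-sin (2 * φ) * (2 * 1)) φ :=
    ((hasDerivAt_id φ).const_mul 2).cos
  have h := (h1.sub (h2.const_mul ((a₀ ^ 2 - d₀ ^ 2) / 4))).sub (h3.const_mul (a₀ * d₀ / 2))
  refine HasDerivAt.congr_deriv (f' := (a₀ ^ 2 + d₀ ^ 2) * 1 / 2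
    - (a₀ ^ 2 - d₀ ^ 2) / 4 * (cos (2 * φ) * (2 * 1)) - a₀ * d₀ / 2 * (-sin (2 * φ) * (2 * 1)))
    h ?_
  linear_combination (-(a₀ ^ 2 - d₀ ^ 2) / 2) * cos_two_mul φ + a₀ * d₀ * sin_two_mul φ
    + (-a₀ ^ 2) * sin_sq_add_cos_sq φ

/-- §215 THE PIN VALUE of the leak primitive: if `a₀², d₀² ≤ 1` and `|φ - kπ| ≤ δ` (`k : ℕ`) then
`G(φ) - G(0) ≥ (a₀² + d₀²)φ/2 - δ/2 - δ²` — at a misfire pin `sin 2φ = O(δ)` and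
`1 - cos 2φ = O(δ²)`, so the oscillatory part of `G` all but vanishes and the secular part
`(a₀² + d₀²)φ/2 ≈ (a₀² + d₀²)kπ/2` survives whole. [derived: this file §215] -/
theorem leakPrim_pin {a₀ d₀ φ δ : ℝ} (k : ℕ) (ha : a₀ ^ 2 ≤ 1) (hd : d₀ ^ 2 ≤ 1)
    (hpin : |φ - k * π| ≤ δ) :
    (a₀ ^ 2 + d₀ ^ 2) * φ / 2 - δ / 2 - δ ^ 2 ≤ leakPrim a₀ d₀ φ - leakPrim a₀ d₀ 0 := by
  have hs2 : sin (2 * φ) = sin (2 * (φ - k * π)) := by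
    have h := Real.sin_sub_nat_mul_pi (2 * φ) (2 * k)
    rw [pow_mul, neg_one_sq, one_pow, one_mul] at h
    rw [← h]
    congr 1
    push_cast
    ring
  have hsin2 : |sin (2 * φ)| ≤ 2 * δ := by
    rw [hs2]
    calc |sin (2 * (φ - k * π))| ≤ |2 * (φ - k * π)| := Real.abs_sin_le_abs
      _ = 2 * |φ - k * π| := by rw [abs_mul, abs_two]
      _ ≤ 2 * δ := by linarith only [hpin]
  have hsq : sin (φ - k * π) ^ 2 = sin φ ^ 2 := by
    have h1 : ((-1 : ℝ) ^ k) ^ 2 = 1 := by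
      rw [← pow_mul, mul_comm, pow_mul]
      norm_num
    rw [Real.sin_sub_nat_mul_pi, mul_pow, h1, one_mul]
  have hsinφ : sin φ ^ 2 ≤ δ ^ 2 := by
    rw [← hsq]
    calc sin (φ - k * π) ^ 2 ≤ (φ - k * π) ^ 2 := Real.sin_sq_le_sq
      _ = |φ - k * π| ^ 2 := (sq_abs _).symm
      _ ≤ δ ^ 2 := pow_le_pow_left₀ (abs_nonneg _) hpin 2
  have hcos2 : 1 - cos (2 * φ) = 2 * sin φ ^ 2 := by
    rw [cos_two_mul, cos_sq']
    ring
  have hG : leakPrim a₀ d₀ φ - leakPrim a₀ d₀ 0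
      = (a₀ ^ 2 + d₀ ^ 2) * φ / 2 - (a₀ ^ 2 - d₀ ^ 2) / 4 * sin (2 * φ)
        + a₀ * d₀ / 2 * (1 - cos (2 * φ)) := by
    simp only [leakPrim, mul_zero, sin_zero, cos_zero]
    ring
  rw [hG, hcos2]
  have h1 : |(a₀ ^ 2 - d₀ ^ 2) / 4 * sin (2 * φ)| ≤ δ / 2 := by
    rw [abs_mul]
    have hA : |(a₀ ^ 2 - d₀ ^ 2) / 4| ≤ 1 / 4 := by
      rw [abs_div, abs_of_pos (by norm_num : (0 : ℝ) < 4)]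
      have : |a₀ ^ 2 - d₀ ^ 2| ≤ 1 :=
        abs_sub_le_iff.2
          ⟨by nlinarith only [ha, sq_nonneg d₀], by nlinarith only [hd, sq_nonneg a₀]⟩
      linarith only [this]
    calc |(a₀ ^ 2 - d₀ ^ 2) / 4| * |sin (2 * φ)| ≤ 1 / 4 * (2 * δ) :=
          mul_le_mul hA hsin2 (abs_nonneg _) (by norm_num)
      _ = δ / 2 := by ring
  have h2 : |a₀ * d₀ / 2 * (2 * sin φ ^ 2)| ≤ δ ^ 2 := by
    have had : |a₀ * d₀| ≤ 1 := by
      rw [abs_mul]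
      calc |a₀| * |d₀| ≤ 1 * 1 :=
            mul_le_mul ((sq_le_one_iff_abs_le_one _).1 ha) ((sq_le_one_iff_abs_le_one _).1 hd)
              (abs_nonneg _) zero_le_one
        _ = 1 := one_mul 1
    rw [show a₀ * d₀ / 2 * (2 * sin φ ^ 2) = a₀ * d₀ * sin φ ^ 2 by ring, abs_mul,
      abs_of_nonneg (sq_nonneg (sin φ))]
    calc |a₀ * d₀| * sin φ ^ 2 ≤ 1 * δ ^ 2 := mul_le_mul had hsinφ (sq_nonneg _) zero_le_one
      _ = δ ^ 2 := one_mul _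
  linarith only [h1, h2, le_abs_self ((a₀ ^ 2 - d₀ ^ 2) / 4 * sin (2 * φ)),
    neg_abs_le (a₀ * d₀ / 2 * (2 * sin φ ^ 2))]

/-! ## §216 The leak comparison: output growth against the leak primitive of the dose phase -/

/-! ## §216 The leak comparison: output against dose phase under a trigger cap -/

/-- §216 THE LEAK COMPARISON (any member `rotorCircuit K M ε ρ` from `delayInit`, `ε, K ≥ 0`,
`ρ > 0`, any trigger primitive `C`). On a window `0 ≤ r ≤ T'` on which the trigger is capped,
`c ≤ c_M` (`c_M > 0`), with `Φ(t) = (C(t) - C(r))/ρ²`, `G` the leak primitive of the entry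
carrier `(a(r), d(r))` and `L = ε + ρ²e^{-M} + Kã(T')`:
`ã(T') - ã(r) ≥ (Kρ²/c_M)·(G(Φ(T')) - G(0)) - 6KL(T' - r)²`.
Mechanism: `W = ã - (Kρ²/c_M)·G∘Φ` has `W' = Kd² - K(sin Φ·a(r) + cos Φ·d(r))²·(c/c_M)
≥ K(d² - S²) ≥ -K|d - S|·|d + S| ≥ -6KL(T' - r)` by part 14 §43 (`|d - S| ≤ 2L(t - r)`,
`|d + S| ≤ 3`). [derived: part 14 §43 `knob_phase_tracking_d`; this file §215] -/
theorem leak_floor {M : ℝ} (hX : ∀ t, HasDerivAt X (RotorKnob.rotorCircuit K M ε ρ (X t)) t)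
    (h0 : X 0 = delayInit) (hC : ∀ t, HasDerivAt C (X t 2) t) (hε : 0 ≤ ε) (hK : 0 ≤ K)
    (hρ : 0 < ρ) {r T' cM : ℝ} (hr : 0 ≤ r) (hrT : r ≤ T') (hcM : 0 < cM)
    (hc : ∀ t ∈ Icc r T', X t 2 ≤ cM) :
    K * ρ ^ 2 / cM * (leakPrim (X r 0) (X r 3) ((C T' - C r) / ρ ^ 2)
        - leakPrim (X r 0) (X r 3) 0)
      - 6 * K * (ε + ρ ^ 2 * exp (-M) + K * X T' 4) * (T' - r) ^ 2 ≤ X T' 4 - X r 4 := by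
  obtain ⟨L, hL⟩ : ∃ L : ℝ, L = ε + ρ ^ 2 * exp (-M) + K * X T' 4 := ⟨_, rfl⟩
  obtain ⟨κ, hκ⟩ : ∃ κ : ℝ, κ = K * ρ ^ 2 / cM := ⟨_, rfl⟩
  rw [← hL, ← hκ]
  have hT0 : 0 ≤ T' := hr.trans hrT
  have hL0 : 0 ≤ L := by
    rw [hL]
    have := RotorKnob.e_nonneg hX h0 hK hT0
    positivity
  have hΦ : ∀ t, HasDerivAt (fun s => (C s - C r) / ρ ^ 2) (X t 2 / ρ ^ 2) t := fun t =>
    ((hC t).sub_const (C r)).div_const (ρ ^ 2)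
  have hW : ∀ t, HasDerivAt
      (fun s => X s 4 - κ * leakPrim (X r 0) (X r 3) ((C s - C r) / ρ ^ 2))
      (K * X t 3 ^ 2 - κ * ((sin ((C t - C r) / ρ ^ 2) * X r 0
        + cos ((C t - C r) / ρ ^ 2) * X r 3) ^ 2 * (X t 2 / ρ ^ 2))) t := by
    intro t
    have h := ((hasDerivAt_leakPrim (X r 0) (X r 3) ((C t - C r) / ρ ^ 2)).comp t
      (hΦ t)).const_mul κ
    exact (RotorKnob.hasDerivAt_e hX t).sub h
  -- the derivative is bounded below on the window
  have hderiv : ∀ t ∈ Icc r T', -(6 * K * L * (T' - r))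
      ≤ K * X t 3 ^ 2 - κ * ((sin ((C t - C r) / ρ ^ 2) * X r 0
        + cos ((C t - C r) / ρ ^ 2) * X r 3) ^ 2 * (X t 2 / ρ ^ 2)) := by
    intro t ht
    obtain ⟨S, hS⟩ : ∃ S : ℝ, S = sin ((C t - C r) / ρ ^ 2) * X r 0
      + cos ((C t - C r) / ρ ^ 2) * X r 3 := ⟨_, rfl⟩
    rw [← hS]
    have hρ2 : (0 : ℝ) < ρ ^ 2 := by positivity
    -- the rotor term is at most `K S²`
    have hrot : κ * (S ^ 2 * (X t 2 / ρ ^ 2)) = K * S ^ 2 * (X t 2 / cM) := by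
      rw [hκ]
      field_simp
    have hcap : X t 2 / cM ≤ 1 := (div_le_one hcM).2 (hc t ht)
    have hrot' : K * S ^ 2 * (X t 2 / cM) ≤ K * S ^ 2 :=
      (mul_le_mul_of_nonneg_left hcap (by positivity)).trans_eq (mul_one _)
    -- the tracking law of part 14 §43
    have htr := knob_phase_tracking_d hX h0 hC hε hK hr ht.1
    rw [← hS] at htr
    have hmono : X t 4 ≤ X T' 4 := RotorKnob.rotorCircuit_output_monotone hK hX ht.2
    have hLt : ε + ρ ^ 2 * exp (-M) + K * X t 4 ≤ L := by
      rw [hL]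
      linarith only [mul_le_mul_of_nonneg_left hmono hK]
    have hdS : |X t 3 - S| ≤ 2 * (L * (T' - r)) := by
      refine htr.trans ?_
      have h1 : (ε + ρ ^ 2 * exp (-M) + K * X t 4) * (t - r) ≤ L * (t - r) :=
        mul_le_mul_of_nonneg_right hLt (by linarith only [ht.1])
      have h2 : L * (t - r) ≤ L * (T' - r) :=
        mul_le_mul_of_nonneg_left (by linarith only [ht.2]) hL0
      linarith only [h1, h2]
    have hsum : |X t 3 + S| ≤ 3 := by
      have hd1 := RotorKnob.traj_abs_le_one hX h0 t 3
      have ha0 := RotorKnob.traj_abs_le_one hX h0 r 0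
      have hd0 := RotorKnob.traj_abs_le_one hX h0 r 3
      have hS2 : |S| ≤ 2 := by
        rw [hS]
        refine (abs_add_le _ _).trans ?_
        rw [abs_mul, abs_mul]
        have e1 : |sin ((C t - C r) / ρ ^ 2)| * |X r 0| ≤ 1 * 1 :=
          mul_le_mul (abs_sin_le_one _) ha0 (abs_nonneg _) zero_le_one
        have e2 : |cos ((C t - C r) / ρ ^ 2)| * |X r 3| ≤ 1 * 1 :=
          mul_le_mul (abs_cos_le_one _) hd0 (abs_nonneg _) zero_le_one
        linarith only [e1, e2]
      exact (abs_add_le _ _).trans (by linarith only [hd1, hS2])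
    have hprod : |(X t 3 - S) * (X t 3 + S)| ≤ 2 * (L * (T' - r)) * 3 := by
      rw [abs_mul]
      exact mul_le_mul hdS hsum (abs_nonneg _) (by positivity)
    have hprod' := neg_abs_le ((X t 3 - S) * (X t 3 + S))
    have hsq : X t 3 ^ 2 - S ^ 2 = (X t 3 - S) * (X t 3 + S) := by ring
    have hlow : -(6 * L * (T' - r)) ≤ X t 3 ^ 2 - S ^ 2 := by
      rw [hsq]
      linarith only [hprod, hprod']
    have := mul_le_mul_of_nonneg_left hlow hK
    rw [hrot]
    nlinarith only [this, hrot']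
  -- integrate the comparison
  have hWd : Differentiable ℝ
      (fun s => X s 4 - κ * leakPrim (X r 0) (X r 3) ((C s - C r) / ρ ^ 2)) :=
    fun t => (hW t).differentiableAt
  have key := (convex_Icc r T').mul_sub_le_image_sub_of_le_deriv hWd.continuous.continuousOn
    hWd.differentiableOn (C := -(6 * K * L * (T' - r)))
    (fun t ht => by rw [(hW t).deriv]; exact hderiv t (interior_subset ht))
    r (left_mem_Icc.2 hrT) T' (right_mem_Icc.2 hrT) hrT
  simp only [sub_self, zero_div] at key
  have hsq : (T' - r) ^ 2 = (T' - r) * (T' - r) := sq _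
  rw [hsq]
  linarith only [key]

/-! ## §217 The leak law of one pulse on the lattice -/

end Summit.NavierStokesRegularity.FluidComputer.GateBudget
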